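import Literature.MathematicalPhysics.QuantumFieldTheory.Balaban1983to89.HaarDensitySymplecticChart
import Literature.MathematicalPhysics.QuantumFieldTheory.Balaban1983to89.LogChartBilinearForm

/-!
# `Balaban1983to89.SymplecticLogChartTwinBridge` — THE TWO LOG CHARTS OF THE SYMPLECTIC GROUPS IN THE TREE ARE ONE:
# p28's `complexSymplecticLogChart J` / `symplecticSubgroup J` (File F `HaarDensitySymplecticChart`) and the pre-cell
# `formLogChart J` / `symplecticLogChart l` / `compactSymplecticLogChart l` (`LogChartBilinearForm`)

statement-level skeleton of published theorems with citation tags; proofs where landed; nothing here is a claim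
about the Yang–Mills mass gap

Mega-formalization `lit-balaban` (HOME `run/shared/lean/pub/lit-balaban/`), unit `lit-balaban-r20` gen 36 (B12 fold
owner ∕ DEFINITIONS steward; register `lit-balaban-r20/DEFINITIONS.md` v1.32, pairs H24–H26; ruling G.5-1 «KEEP BOTH,
BRIDGE»; TAKING 2026-08-22T20:37Z).  [Balaban1987RG1] §0 pp. 251–252 reads the gauge group as «a compact Lie group
G … a Lie subgroup of a group of complex unitary matrices, for example G ⊂ U(N)», and the tree carries such groups
as log-charted closed subgroups (`LogChart`, `BlockAveragingFederbushGValued`).  For the SYMPLECTIC family two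
lineages typed the same objects with transposed conventions:

* `LogChartBilinearForm` (2026-08-19, the `GValued` lineage): `formLogChart J` — carrier `{g : g J gᵀ = J}`, Lie
  algebra `formSkew J = {X : X J + J Xᵀ = 0}`, `ρ = 1/3`; `symplecticLogChart l := formLogChart (Matrix.J l ℂ)`,
  whose carrier is Mathlib's `Matrix.symplecticGroup l ℂ = Sp(2n, ℂ)`; `compactSymplecticLogChart l :=
  unitaryLogChart ⊓ symplecticLogChart l` — «Sp(n) = USp(2n) = U(2n) ∩ Sp(2n, ℂ)», with (0.9) for the tree's
  `fedSol`/`fedM` and print's local polar form on it;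
* `HaarDensitySymplecticChart` (p28 gen 12, File F of the explicit-Haar-density lineage, [Balaban1985UV3] p. 260):
  `complexSymplecticLogChart J hJJ` — carrier `{g : gᵀ J g = J}`, Lie algebra Mathlib's
  `skewAdjointMatricesSubmodule J = {A : Aᵀ J = −J A}` (real scalars), `ρ = 1/3`, for every `J` with `J² = −1`;
  `symplecticSubgroup J ≤ U(m)` (the unitaries with `gᵀ J g = J`), on whose log chart (gen 8's
  `unitarySubgroupLogChart`) the Haar measure with the explicit density `Π_{{j,k}} sinc((θ_j + θ_k)/2)` is stated.

CITATION HEADER.  [Sepanski2007] M. R. Sepanski, *Compact Lie Groups*, GTM 235, §1.1.4.3 (1.14) (PDF p. 46: «Sp(n,ℂ) =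
{g ∈ GL(2n,ℂ) | gᵗJg = J}», «Sp(n) ≅ U(2n) ∩ Sp(n,ℂ)»; NB File F v1 prints «§1.1.4.2», which is SU(n) — p28's own
locator correction for File F v1.1), §6.1.5.2 (type C_n); [Hall2015] B. C. Hall, *Lie Groups, Lie Algebras, and Representations*, GTM 222,
Prop. 3.25 (PDF p. 62: the Lie algebra of Sp(n;ℂ) is {X : ΩXᵗʳΩ = X}, of Sp(n) the same with X* = −X — its two
one-sided readings, XᵗʳΩ = −ΩX and XΩ = −ΩXᵗʳ, are exactly the two conventions bridged in §1), Cor. 3.44 (PDF p. 71);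
[Balaban1987RG1] T. Bałaban, CMP **109** (1987) 249–301, §0 pp. 251–253 ((0.9) `M({𝐔_j}) ∈ G`).

WHAT IS PROVED (theorems only; 0 definitions, 0 named facts, 0 sorry; axioms standard).
* §1 Matrix algebra for `J² = −1`: `AᵀJA = J ⟺ AJAᵀ = J` (`mul_J_mul_transpose_eq`, `transpose_mul_J_mul_eq`:
  `A⁻¹ = −JAᵀJ`, and a left inverse of a square matrix is a right inverse) and `AᵀJ = −JA ⟺ AJ = −JAᵀ`
  (`mul_J_eq_neg`, `transpose_mul_J_eq_neg`: conjugate by `J`).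
* §2 **`complexSymplecticLogChart_eq_formLogChart`: `complexSymplecticLogChart J hJJ = formLogChart J` AS LOG CHARTS**
  for every `J` with `J² = −1` (same carrier, same Lie algebra —
  `skewAdjointMatricesSubmodule_restrictScalars_eq_formSkew` —, same radius); hence
  `image_val_symplecticSubgroup_eq_inf_formLogChart`: `symplecticSubgroup J` read in `M_m(ℂ)` is the carrier of
  `unitaryLogChart ⊓ formLogChart J`.
* §3 At Mathlib's `J = Matrix.J l ℂ`: **`symplecticLogChart l = complexSymplecticLogChart (J l ℂ) _`**,
  **`compactSymplecticLogChart l = unitaryLogChart ⊓ complexSymplecticLogChart (J l ℂ) _`**;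
  `mem_symplecticSubgroup_J_iff` (`u ∈ symplecticSubgroup (J l ℂ) ⟺ ↑u ∈ Matrix.symplecticGroup l ℂ`, Mathlib's
  `SymplecticGroup.mem_iff'`); **`image_val_symplecticSubgroup_J`: p28's `Sp(n) ≤ U(2n)` read in `M_{2n}(ℂ)` IS
  `(compactSymplecticLogChart l).carrier`** (and `exists_symplecticSubgroup_of_mem_compactSymplecticLogChart` back);
  **the log chart of `symplecticSubgroup (J l ℂ)` used by File F has the carrier AND the Lie algebra of
  `compactSymplecticLogChart l`** (`unitarySubgroupLogChart_symplecticSubgroup_carrier_eq` / `_lie_eq`, the latter by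
  gen 8's `LogChart.lie_eq_of_carrier_eq`), and **`compactSymplecticLogChart_lie_eq_symplecticLie`:
  `(compactSymplecticLogChart l).lie = symplecticLie (J l ℂ)`** — File D's `𝔰𝔭_J = 𝔲 ∩ 𝔰𝔭_J(ℂ)`, the space on
  which `det jac = Π sinc` is stated (`mem_compactSymplecticLogChart_lie_iff_mem_symplecticLie` elementwise).

So File F's Haar-measure statement for `Sp(n)` reads on the tree's compact symplectic chart of record, and
`LogChartBilinearForm`'s (0.9) ∕ polar-form theorems read on p28's subgroup; no third carrier is introduced.

HONEST SCOPE.  (i) Pure bookkeeping between two landed typings: nothing printed is asserted beyond what the two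
files assert; no measure-level statement is moved (File F's `lintegral_haar_symplectic_window_eq_prod_sinc` is not
restated).  (ii) `J² = −1` is the only hypothesis of §2 (it is File F's chart hypothesis); `Jᵀ = −J`, `J` real are not
needed here.  (iii) That `Sp(n)` so realised is print's compact symplectic group is [Sepanski2007] §1.1.4.3 (1.14), as in
both files; no quaternionic model.
-/

noncomputable section

open Matrix

namespace Literature.MathematicalPhysics.QuantumFieldTheory.Balaban1983to89.SymplecticLogChartTwinBridge

open HaarDensitySymplecticChart (complexSymplecticLogChart symplecticSubgroup mem_complexSymplecticLogChart_carrier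
  mem_complexSymplecticLogChart_lie isClosed_symplecticSubgroup image_val_symplecticSubgroup
  unitarySubgroupLogChart_carrier_eq inf_lie_eq mem_symplecticSubgroup_iff)
open HaarDensitySymplecticExplicit (symplecticLie mem_symplecticLie_iff)
open LogChartClosedSubgroup (unitarySubgroupLogChart unitarySubgroupLogChart_carrier)

-- Mathlib idiom (as in File D/F, `B12LieComplexification`, `B13HaarSigmaJacobian` §7): the commutator bracket on an
-- associative ring is the NON-instance `LieRing.ofAssociativeRing`, enabled file-locally for `symplecticLie`; it
-- overrides nothing (no global `LieRing (Matrix m m ℂ)`).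
attribute [local instance 100] LieRing.ofAssociativeRing

variable {m : Type*} [Fintype m] [DecidableEq m] {J : Matrix m m ℂ}

/-! ## §0  Two log charts with the same carrier, Lie algebra and radius are equal -/

/-- Structure extensionality for the tree's `LogChart` (data fields `carrier`, `lie`, `ρ`; the remaining fields
are propositions). [folklore] -/
private theorem logChart_ext {𝔸 : Type*} [NormedRing 𝔸] [NormedAlgebra ℂ 𝔸] {c₁ c₂ : LogChart 𝔸}
    (h₁ : c₁.carrier = c₂.carrier) (h₂ : c₁.lie = c₂.lie) (h₃ : c₁.ρ = c₂.ρ) : c₁ = c₂ := by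
  cases c₁
  cases c₂
  cases h₁
  cases h₂
  cases h₃
  rfl

/-! ## §1  Matrix algebra: for `J² = −1` the two transposed conventions define the same sets -/

/-- `AᵀJA = J ⟹ AJAᵀ = J` for `J² = −1`: `A⁻¹ = −JAᵀJ` (a left inverse of a square matrix is a right
inverse), hence `AJAᵀJ = −1`, hence `AJAᵀ = J`. [cite: Sepanski2007, §1.1.4.3 (1.14)] -/
theorem mul_J_mul_transpose_eq (hJJ : J * J = -1) {A : Matrix m m ℂ} (h : Aᵀ * J * A = J) :
    A * J * Aᵀ = J := by
  have h1 : (-(J * Aᵀ * J)) * A = 1 := by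
    calc (-(J * Aᵀ * J)) * A = -(J * (Aᵀ * J * A)) := by noncomm_ring
      _ = 1 := by rw [h, hJJ, neg_neg]
  have h2 : A * (-(J * Aᵀ * J)) = 1 := mul_eq_one_comm.1 h1
  calc A * J * Aᵀ = A * J * Aᵀ * (-(J * J)) := by rw [hJJ, neg_neg, Matrix.mul_one]
    _ = (A * (-(J * Aᵀ * J))) * J := by noncomm_ring
    _ = J := by rw [h2, Matrix.one_mul]

/-- `AJAᵀ = J ⟹ AᵀJA = J` for `J² = −1` (the previous lemma for `Aᵀ`). [cite: Sepanski2007, §1.1.4.3 (1.14)] -/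
theorem transpose_mul_J_mul_eq (hJJ : J * J = -1) {A : Matrix m m ℂ} (h : A * J * Aᵀ = J) :
    Aᵀ * J * A = J := by
  have h' : (Aᵀ)ᵀ * J * Aᵀ = J := by rwa [Matrix.transpose_transpose]
  simpa only [Matrix.transpose_transpose] using mul_J_mul_transpose_eq hJJ h'

/-- `AᵀJ = −JA ⟹ AJ = −JAᵀ` for `J² = −1` (conjugate the equation by `J`). [cite: Hall2015, Prop. 3.25] -/
theorem mul_J_eq_neg (hJJ : J * J = -1) {A : Matrix m m ℂ} (h : Aᵀ * J = -(J * A)) :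
    A * J = -(J * Aᵀ) := by
  calc A * J = (-(J * J)) * A * J := by rw [hJJ, neg_neg, Matrix.one_mul]
    _ = J * (-(J * A)) * J := by noncomm_ring
    _ = J * (Aᵀ * J) * J := by rw [h]
    _ = -(J * Aᵀ * (-(J * J))) := by noncomm_ring
    _ = -(J * Aᵀ) := by rw [hJJ, neg_neg, Matrix.mul_one]

/-- `AJ = −JAᵀ ⟹ AᵀJ = −JA` for `J² = −1` (the previous lemma for `Aᵀ`). [cite: Hall2015, Prop. 3.25] -/
theorem transpose_mul_J_eq_neg (hJJ : J * J = -1) {A : Matrix m m ℂ} (h : A * J = -(J * Aᵀ)) :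
    Aᵀ * J = -(J * A) := by
  have h' : (Aᵀ)ᵀ * J = -(J * Aᵀ) := by rwa [Matrix.transpose_transpose]
  simpa only [Matrix.transpose_transpose] using mul_J_eq_neg hJJ h'

/-! ## §2  The two `Sp_J(m, ℂ)` log charts are ONE chart (every `J` with `J² = −1`) -/

section Charts

open scoped Matrix.Norms.L2Operator

/-- **Same carrier**: p28's `{g : gᵀJg = J}` = the tree's `Aut(J) = {g : gJgᵀ = J}` for `J² = −1`.
[cite: Sepanski2007, §1.1.4.3 (1.14)] -/
theorem complexSymplecticLogChart_carrier_eq (hJJ : J * J = -1) :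
    (complexSymplecticLogChart J hJJ).carrier = (formLogChart J).carrier := by
  ext A
  rw [mem_complexSymplecticLogChart_carrier, mem_formLogChart_carrier]
  exact ⟨mul_J_mul_transpose_eq hJJ, transpose_mul_J_mul_eq hJJ⟩

/-- **Same Lie algebra**: Mathlib's `skewAdjointMatricesSubmodule J = {A : AᵀJ = −JA}` (real scalars) = the tree's
`formSkew J = {X : XJ + JXᵀ = 0}` for `J² = −1`. [cite: Hall2015, Prop. 3.25] -/
theorem complexSymplecticLogChart_lie_eq (hJJ : J * J = -1) :
    (complexSymplecticLogChart J hJJ).lie = (formLogChart J).lie := by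
  ext A
  rw [mem_complexSymplecticLogChart_lie, mem_formLogChart_lie, ← eq_neg_iff_add_eq_zero]
  exact ⟨mul_J_eq_neg hJJ, transpose_mul_J_eq_neg hJJ⟩

/-- The Lie-algebra equality read without charts: `(skewAdjointMatricesSubmodule J).restrictScalars ℝ = formSkew J`
for `J² = −1`. [cite: Hall2015, Prop. 3.25] -/
theorem skewAdjointMatricesSubmodule_restrictScalars_eq_formSkew (hJJ : J * J = -1) :
    (skewAdjointMatricesSubmodule J).restrictScalars ℝ = formSkew J :=
  complexSymplecticLogChart_lie_eq hJJ

/-- **THE TWO `Sp_J(m, ℂ)` LOG CHARTS ARE EQUAL** (`ρ = 1/3` on both sides): p28 g12's `complexSymplecticLogChart J hJJ`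
(File F `HaarDensitySymplecticChart`) IS the pre-cell chart `formLogChart J` of `LogChartBilinearForm`.
[cite: Sepanski2007, §1.1.4.3 (1.14)] [cite: Hall2015, Prop. 3.25] -/
theorem complexSymplecticLogChart_eq_formLogChart (hJJ : J * J = -1) :
    complexSymplecticLogChart J hJJ = formLogChart J :=
  logChart_ext (complexSymplecticLogChart_carrier_eq hJJ) (complexSymplecticLogChart_lie_eq hJJ)
    (by rw [formLogChart_ρ]; rfl)

/-- p28's compact subgroup `symplecticSubgroup J ≤ U(m)` read in `M_m(ℂ)` is the carrier of the tree's
`unitaryLogChart ⊓ formLogChart J` (every `J` with `J² = −1`). [cite: Sepanski2007, §6.1.5.2, §1.1.4.3 (1.14)] -/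
theorem image_val_symplecticSubgroup_eq_inf_formLogChart (hJJ : J * J = -1) :
    (Subtype.val '' (symplecticSubgroup J : Set (Matrix.unitaryGroup m ℂ)) : Set (Matrix m m ℂ)) =
      ((unitaryLogChart m).inf (formLogChart J)).carrier := by
  rw [image_val_symplecticSubgroup hJJ, complexSymplecticLogChart_eq_formLogChart hJJ]

end Charts

/-! ## §3  At Mathlib's `J = [[0, −1], [1, 0]]`: `Sp(2n, ℂ)` and the compact `Sp(n)` of `LogChartBilinearForm` -/

section MathlibJ

open scoped Matrix.Norms.L2Operator

variable {l : Type*} [Fintype l] [DecidableEq l]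

/-- **`symplecticLogChart l` (carrier = Mathlib's `Matrix.symplecticGroup l ℂ = Sp(2n, ℂ)`) IS p28's chart at
`J = Matrix.J l ℂ`.** [cite: Sepanski2007, §1.1.4.3 (1.14)] -/
theorem symplecticLogChart_eq_complexSymplecticLogChart :
    symplecticLogChart l = complexSymplecticLogChart (Matrix.J l ℂ) (Matrix.J_squared l ℂ) :=
  (complexSymplecticLogChart_eq_formLogChart (Matrix.J_squared l ℂ)).symm

/-- **The compact chart `compactSymplecticLogChart l` (`Sp(n) = U(2n) ∩ Sp(2n, ℂ)`) IS `unitaryLogChart ⊓` p28's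
chart.** [cite: Sepanski2007, §6.1.5.2] -/
theorem compactSymplecticLogChart_eq_inf :
    compactSymplecticLogChart l =
      (unitaryLogChart (l ⊕ l)).inf (complexSymplecticLogChart (Matrix.J l ℂ) (Matrix.J_squared l ℂ)) := by
  rw [← symplecticLogChart_eq_complexSymplecticLogChart]
  rfl

/-- Membership in p28's `symplecticSubgroup (Matrix.J l ℂ)` is membership of the underlying matrix in Mathlib's
`Matrix.symplecticGroup l ℂ` (`SymplecticGroup.mem_iff'`: `A ∈ Sp ⟺ AᵀJA = J`). [cite: Sepanski2007, §1.1.4.3 (1.14)] -/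
theorem mem_symplecticSubgroup_J_iff {u : Matrix.unitaryGroup (l ⊕ l) ℂ} :
    u ∈ symplecticSubgroup (Matrix.J l ℂ) ↔ (u : Matrix (l ⊕ l) (l ⊕ l) ℂ) ∈ Matrix.symplecticGroup l ℂ := by
  rw [mem_symplecticSubgroup_iff, SymplecticGroup.mem_iff']

/-- **p28's `Sp(n) ≤ U(2n)` read in `M_{2n}(ℂ)` IS the carrier of the tree's `compactSymplecticLogChart l`.**
[cite: Sepanski2007, §6.1.5.2, §1.1.4.3 (1.14)] -/
theorem image_val_symplecticSubgroup_J :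
    (Subtype.val '' (symplecticSubgroup (Matrix.J l ℂ) : Set (Matrix.unitaryGroup (l ⊕ l) ℂ)) :
        Set (Matrix (l ⊕ l) (l ⊕ l) ℂ)) = (compactSymplecticLogChart l).carrier := by
  rw [image_val_symplecticSubgroup (Matrix.J_squared l ℂ), compactSymplecticLogChart_eq_inf]

/-- Conversely every element of the tree's compact symplectic chart is (the value of) an element of p28's subgroup —
e.g. the tree's `fedM δ U`, `fedSol W` of `LogChartBilinearForm` §4 ((0.9) for `Sp(n)`). [cite: Balaban1987RG1, §0 (0.9) p.253] -/
theorem exists_symplecticSubgroup_of_mem_compactSymplecticLogChart {A : Matrix (l ⊕ l) (l ⊕ l) ℂ}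
    (hA : A ∈ (compactSymplecticLogChart l).carrier) :
    ∃ u ∈ symplecticSubgroup (Matrix.J l ℂ), (u : Matrix (l ⊕ l) (l ⊕ l) ℂ) = A := by
  rw [← image_val_symplecticSubgroup_J] at hA
  obtain ⟨u, hu, rfl⟩ := hA
  exact ⟨u, hu, rfl⟩

/-- **The log chart of `Sp(n) ≤ U(2n)` used by File F (gen 8's `unitarySubgroupLogChart`) has the carrier of
`compactSymplecticLogChart l`.** [cite: Sepanski2007, §6.1.5.2] -/
theorem unitarySubgroupLogChart_symplecticSubgroup_carrier_eq :
    (unitarySubgroupLogChart (symplecticSubgroup (Matrix.J l ℂ)) isClosed_symplecticSubgroup).carrier =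
      (compactSymplecticLogChart l).carrier := by
  rw [unitarySubgroupLogChart_carrier_eq (Matrix.J_squared l ℂ), compactSymplecticLogChart_eq_inf]

/-- **… and therefore the same Lie algebra** (two log charts with the same carrier have the same Lie algebra,
gen 8's `LogChart.lie_eq_of_carrier_eq`). [cite: Hall2015, Cor. 3.44] [cite: Sepanski2007, §6.1.5.2] -/
theorem unitarySubgroupLogChart_symplecticSubgroup_lie_eq :
    (unitarySubgroupLogChart (symplecticSubgroup (Matrix.J l ℂ)) isClosed_symplecticSubgroup).lie =
      (compactSymplecticLogChart l).lie :=
  LogChart.lie_eq_of_carrier_eq unitarySubgroupLogChart_symplecticSubgroup_carrier_eq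

/-- **The Lie algebra of the tree's `compactSymplecticLogChart l` is p28's `symplecticLie (Matrix.J l ℂ)`**
(`𝔰𝔭(n) = 𝔲(2n) ∩ 𝔰𝔭(2n, ℂ)`; File D's object, on which the explicit density
`det jac = Π_{{j,k}} sinc((θ_j + θ_k)/2)` is stated). [cite: Sepanski2007, §6.1.5.2] -/
theorem compactSymplecticLogChart_lie_eq_symplecticLie :
    (compactSymplecticLogChart l).lie = (symplecticLie (Matrix.J l ℂ)).toSubmodule := by
  rw [compactSymplecticLogChart_eq_inf]
  exact inf_lie_eq (Matrix.J_squared l ℂ)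

/-- Elementwise: `X ∈ 𝔰𝔭(n)` in the tree's sense (`X* = −X ∧ XJ + JXᵀ = 0`) iff `X ∈ symplecticLie (Matrix.J l ℂ)`
(`Xᴴ = −X ∧ XᵀJ = −JX`). [cite: Sepanski2007, §6.1.5.2] -/
theorem mem_compactSymplecticLogChart_lie_iff_mem_symplecticLie {X : Matrix (l ⊕ l) (l ⊕ l) ℂ} :
    X ∈ (compactSymplecticLogChart l).lie ↔ X ∈ symplecticLie (Matrix.J l ℂ) := by
  rw [compactSymplecticLogChart_lie_eq_symplecticLie, LieSubalgebra.mem_toSubmodule]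

end MathlibJ

end Literature.MathematicalPhysics.QuantumFieldTheory.Balaban1983to89.SymplecticLogChartTwinBridge
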